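import Literature.AnabelianGeometry.EtaleTheta.ContH1ClosedComplements
import Literature.AnabelianGeometry.EtaleTheta.ContH1InfRes
import Literature.AnabelianGeometry.EtaleTheta.GalSectTorsorTrivialisation
import Literature.AnabelianGeometry.AbsoluteAnabelian.ZHatCompletionAdicCompleteness
import HarnessLib

/-!
# [GalSect] §4 p.33: the splitting classes at a cusp FORM A TORSOR over `H¹` — PROVED at the interface level

S. Mochizuki, *Galois sections in absolute anabelian geometry* [GalSect], Nagoya Math. J. **179** (2005), §4
p.33: "the splittings of `1 → I_x → D_x → G_K → 1` … form a torsor over `H¹(G_K, Ẑ(1))`"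
[cite: MochizukiGalSect2005, §4 p.33]; classical input: Brown, *Cohomology of Groups*, Ch. IV §2 Prop. 2.3
(complements of an abelian normal subgroup modulo conjugation ↔ `H¹`) [cite: Brown1982CohomologyGroups, Ch. IV §2 Prop. 2.1 and Prop. 2.3].

Cell abc-iut, layer L2 (NV programme / census lineage of abc-iut-w5-d029; CLAIM STATUS 2026-08-26T07:14:15Z).
abc-iut-w5-d062's records `GalSect.CuspPair.TorsorData` / `GalSect.CuspidalTorsorData` carry the torsor as
DATA «certified only through the origin predicate» (`GalSectCuspidalTorsors.lean` header); `p426023` showed only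
«torsor structure ⇔ trivialisation».  Here the GENUINE structure of print is constructed: for an abstract
cuspidal pair `P = (D, I)` in a topological group (`GalSect.CuspPair`) with `D` closed, `I` compact and
abelian, and ONE splitting,

* `CuspPair.splittingsEquivClosedComplements` — the splittings of `P` ARE the closed complements of `I` in
  `D` (transported into the subgroup `↥D`, where `I` is normal), compatibly with `I`-conjugation;
* **`CuspPair.splittingClassEquivResKer`** — `P.SplittingClass ≃ Ker(res : H¹(D, I) → H¹(I, I))`
  (`ContH1ClosedComplements.complementClassEquivResKer`: the classes form a COSET of the kernel in `H¹(D, I)`,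
  translated by the chosen base splitting; the kernel is `H¹(D/I, I^{}) = H¹(G_K, Ẑ(1))` of print by
  inflation–restriction — that identification is not typed here);
* **`CuspPair.torsorDataH1 : P.TorsorData ↥(Ker res)`** — the free transitive action (via
  `TorsorData.ofEquiv`, p426023), print's sentence for `P`;
* `TemperedCurve.cuspTorsorH1` — the same for `(D_x, I_x)` of ANY `X : TemperedCurve p` at a cusp `x` with a
  splitting (`I_x ≅ Ẑ` gives compact + abelian: `inertia_equiv_zHat`), `Π^tp` Hausdorff-ish (`T1`);
* the UN-VACUOUS instance at the χ-twisted model WITH a cusp `curveχ′ p` (p429840) — its canonical section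
  `G_{ℚ_p} ↪ b^Ẑ ⋊ G_{ℚ_p}` is a splitting — is the sequel `GalSectSplittingsCohomologyChi.lean`
  (`SettingModel.cuspTorsorH1χ`); L3's witness `TemperedCurveGroupLevelDataNonVacuity2` (abc-iut-w5-d040:
  `D_x = G_{ℚ_p} × îa(Ẑ)`, splitting `G_{ℚ_p} × 1`) is another cusp to which `cuspTorsorH1` applies.

HONEST FRAMING: interface-level group theory; the structure group is `Ker(res)`, print's `H¹(G_K, Ẑ(1))` only
after inflation–restriction and its identification with `(K^×)^∧` (Kummer theory — the origin predicate's
content, untouched); [GalSect] is refereed; typed ≠ proved for anything of [EtTh]; no side taken on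
[IUTchIII] Cor. 3.12.  Defs: the transport equivalences and the torsor (class (b) constructions over frozen
records; no field added, no instance, no Prop fact).
-/

noncomputable section

namespace Literature.AnabelianGeometry.EtaleTheta

open scoped Pointwise
open _root_.Topology _root_.Function

namespace GalSect

namespace CuspPair

variable {G : Type*} [Group G] [TopologicalSpace G] [IsTopologicalGroup G] (P : CuspPair G)

/-! ### The pair inside `↥D`: `I` becomes a normal subgroup -/

/-- `I` as a subgroup of `↥D`. [cite: MochizukiGalSect2005, §4 p.33] -/
abbrev ID : Subgroup P.D := P.I.subgroupOf P.D

omit [IsTopologicalGroup G] in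
/-- `I ⊴ D` (from `conj_I`). [cite: MochizukiGalSect2005, §4 p.33] -/
theorem ID_normal : P.ID.Normal := by
  rw [Subgroup.normal_subgroupOf_iff P.I_le]
  intro h k hh hk
  have : k * h * k⁻¹ ∈ MulAut.conj k • P.I :=
    (Subgroup.mem_smul_pointwise_iff_exists _ _ _).mpr ⟨h, hh, rfl⟩
  rwa [P.conj_I k hk] at this

omit [IsTopologicalGroup G] in
/-- `I ⊆ ↥D` is compact when `I ⊆ G` is (and `I ≤ D`). [cite: MochizukiGalSect2005, §4 p.33] -/
theorem isCompact_ID (hI : IsCompact (P.I : Set G)) : IsCompact (P.ID : Set P.D) := by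
  rw [Topology.IsInducing.subtypeVal.isCompact_iff]
  convert hI using 1
  ext x
  constructor
  · rintro ⟨y, hy, rfl⟩; exact hy
  · intro hx; exact ⟨⟨x, P.I_le hx⟩, hx, rfl⟩

/-! ### Splittings of `P` = closed complements of `I` in `↥D` -/

omit [IsTopologicalGroup G] in
/-- Conjugation by `d ∈ D` commutes with passing to `↥D`. [cite: MochizukiGalSect2005, §4 p.33] -/
theorem subgroupOf_conj_smul {S : Subgroup G} (hS : S ≤ P.D) {d : G} (hd : d ∈ P.D) :
    (MulAut.conj d • S).subgroupOf P.D = MulAut.conj (⟨d, hd⟩ : P.D) • S.subgroupOf P.D := by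
  ext x
  rw [Subgroup.mem_subgroupOf, Subgroup.mem_smul_pointwise_iff_exists, Subgroup.mem_smul_pointwise_iff_exists]
  constructor
  · rintro ⟨s, hs, hsx⟩
    refine ⟨⟨s, hS hs⟩, Subgroup.mem_subgroupOf.mpr hs, Subtype.ext ?_⟩
    simpa [MulAut.smul_def, MulAut.conj_apply] using hsx
  · rintro ⟨y, hy, rfl⟩
    exact ⟨y, Subgroup.mem_subgroupOf.mp hy, by simp [MulAut.smul_def, MulAut.conj_apply]⟩

omit [IsTopologicalGroup G] in
/-- A splitting of `P`, seen in `↥D`, is a closed complement of `I`. [cite: MochizukiGalSect2005, §4 p.33] -/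
theorem isClosedComplement_of_mem_splittings {S : Subgroup G} (hS : S ∈ P.splittings) :
    ContH1.IsClosedComplement P.ID ⊤ (S.subgroupOf P.D) := by
  obtain ⟨hcl, hle, hinf, hsup⟩ := hS
  refine ⟨?_, le_top, ?_, ?_⟩
  · exact hcl.preimage continuous_subtype_val
  · rw [Subgroup.disjoint_def]
    intro x hxI hxS
    have : (x : G) ∈ S ⊓ P.I := ⟨Subgroup.mem_subgroupOf.mp hxS, Subgroup.mem_subgroupOf.mp hxI⟩
    rw [hinf] at this
    exact Subtype.ext (Subgroup.mem_bot.mp this)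
  · rw [← Subgroup.subgroupOf_sup P.I_le hle, sup_comm, hsup, Subgroup.subgroupOf_self]

omit [IsTopologicalGroup G] in
/-- Conversely a closed complement of `I` in `↥D` (with `D` closed) is a splitting of `P`.
[cite: MochizukiGalSect2005, §4 p.33] -/
theorem map_subtype_mem_splittings (hD : IsClosed (P.D : Set G)) {K : Subgroup P.D}
    (hK : ContH1.IsClosedComplement P.ID ⊤ K) : K.map P.D.subtype ∈ P.splittings := by
  have hinj : Function.Injective P.D.subtype := Subgroup.subtype_injective _
  refine ⟨?_, ?_, ?_, ?_⟩
  · change IsClosed (Subtype.val '' (K : Set P.D))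
    exact hD.isClosedEmbedding_subtypeVal.isClosedMap _ hK.isClosed
  · rintro _ ⟨k, -, rfl⟩; exact k.2
  · have h := congrArg (Subgroup.map P.D.subtype) (hK.disjoint.symm.eq_bot)
    rw [Subgroup.map_inf _ _ P.D.subtype hinj, Subgroup.map_bot, Subgroup.map_subgroupOf_eq_of_le P.I_le] at h
    exact h
  · have h := congrArg (Subgroup.map P.D.subtype) hK.sup_eq
    rw [Subgroup.map_sup, Subgroup.map_subgroupOf_eq_of_le P.I_le, sup_comm] at h
    rw [h]
    ext x
    constructor
    · rintro ⟨y, -, rfl⟩; exact y.2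
    · intro hx; exact ⟨⟨x, hx⟩, Subgroup.mem_top _, rfl⟩

/-- **Splittings of `P` ≃ closed complements of `I` in `↥D`** (`D` closed). [cite: MochizukiGalSect2005, §4 p.33] -/
def splittingsEquivClosedComplements (hD : IsClosed (P.D : Set G)) :
    P.splittings ≃ ContH1.closedComplements P.ID (⊤ : Subgroup P.D) where
  toFun S := ⟨S.1.subgroupOf P.D, P.isClosedComplement_of_mem_splittings S.2⟩
  invFun K := ⟨K.1.map P.D.subtype, P.map_subtype_mem_splittings hD K.2⟩
  left_inv S := Subtype.ext (Subgroup.map_subgroupOf_eq_of_le S.2.2.1)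
  right_inv K := Subtype.ext (Subgroup.comap_map_eq_self_of_injective (Subgroup.subtype_injective P.D) K.1)

omit [IsTopologicalGroup G] in
/-- The transport respects the conjugacy relations: `I`-conjugate splittings ↔ `I`-conjugate complements.
[cite: MochizukiGalSect2005, §4 p.33] -/
theorem inertiaConj_iff_aConj (hD : IsClosed (P.D : Set G)) (S T : P.splittings) :
    P.InertiaConj S.1 T.1 ↔
      ContH1.AConj P.ID (P.splittingsEquivClosedComplements hD S).1 (P.splittingsEquivClosedComplements hD T).1 := by
  constructor
  · rintro ⟨i, hi, hT⟩
    refine ⟨⟨i, P.I_le hi⟩, Subgroup.mem_subgroupOf.mpr hi, ?_⟩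
    change T.1.subgroupOf P.D = MulAut.conj (⟨i, P.I_le hi⟩ : P.D) • S.1.subgroupOf P.D
    rw [hT, P.subgroupOf_conj_smul S.2.2.1]
  · rintro ⟨a, ha, hT⟩
    refine ⟨(a : G), Subgroup.mem_subgroupOf.mp ha, ?_⟩
    change T.1.subgroupOf P.D = MulAut.conj a • S.1.subgroupOf P.D at hT
    have hle : MulAut.conj (a : G) • S.1 ≤ P.D := by
      intro y hy
      obtain ⟨s, hs, rfl⟩ := (Subgroup.mem_smul_pointwise_iff_exists _ _ _).mp hy
      exact P.D.mul_mem (P.D.mul_mem a.2 (S.2.2.1 hs)) (P.D.inv_mem a.2)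
    have h2 : (MulAut.conj (a : G) • S.1).subgroupOf P.D = T.1.subgroupOf P.D := by
      rw [hT, P.subgroupOf_conj_smul S.2.2.1 a.2]
    have h3 := (Subgroup.subgroupOf_inj).mp h2
    rwa [inf_eq_left.mpr hle, inf_eq_left.mpr T.2.2.1, eq_comm] at h3

/-- **Splitting classes ≃ conjugacy classes of closed complements.** [cite: MochizukiGalSect2005, §4 p.33] -/
def splittingClassEquivComplementClass (hD : IsClosed (P.D : Set G)) :
    P.SplittingClass ≃ ContH1.ComplementClass P.ID (⊤ : Subgroup P.D) :=
  Quotient.congr (P.splittingsEquivClosedComplements hD) (P.inertiaConj_iff_aConj hD)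

/-! ### The torsor -/

section Torsor

variable [IsMulCommutative P.I]

/-- **`SplittingClass ≃ Ker(res : H¹(D, I) → H¹(I, I))`** — the splitting classes, through the base
splitting `S₀`, are the kernel of restriction (a COSET of it inside `H¹(D, I)` before translating).
[cite: MochizukiGalSect2005, §4 p.33] -/
def splittingClassEquivResKer [T1Space G] (hD : IsClosed (P.D : Set G)) (hI : IsCompact (P.I : Set G))
    {S₀ : Subgroup G} (hS₀ : S₀ ∈ P.splittings) :
    haveI := P.ID_normal
    P.SplittingClass ≃ ContH1.resKer P.ID (⊤ : Subgroup P.D)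
      (P.isClosedComplement_of_mem_splittings hS₀).le_left :=
  haveI := P.ID_normal
  (P.splittingClassEquivComplementClass hD).trans
    (ContH1.complementClassEquivResKer (P.isClosedComplement_of_mem_splittings hS₀) isClosed_univ
      (P.isCompact_ID hI))

/-- The base splitting class goes to `1`. [cite: MochizukiGalSect2005, §4 p.33] -/
theorem splittingClassEquivResKer_base [T1Space G] (hD : IsClosed (P.D : Set G)) (hI : IsCompact (P.I : Set G))
    {S₀ : Subgroup G} (hS₀ : S₀ ∈ P.splittings) :
    P.splittingClassEquivResKer hD hI hS₀ (SplittingClass.mk P S₀ hS₀) = 1 :=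
  haveI := P.ID_normal
  ContH1.complementClassEquivResKer_base _ _ _

/-- **[GalSect] §4: the splitting classes form a TORSOR over `Ker(res) ⊆ H¹(D, I)`** (free transitive
action, transported from left translation in the kernel through `splittingClassEquivResKer`).
[cite: MochizukiGalSect2005, §4 p.33] -/
def torsorDataH1 [T1Space G] (hD : IsClosed (P.D : Set G)) (hI : IsCompact (P.I : Set G))
    {S₀ : Subgroup G} (hS₀ : S₀ ∈ P.splittings) :
    haveI := P.ID_normal
    P.TorsorData ↥(ContH1.resKer P.ID (⊤ : Subgroup P.D) (P.isClosedComplement_of_mem_splittings hS₀).le_left) :=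
  haveI := P.ID_normal
  TorsorData.ofEquiv (P.splittingClassEquivResKer hD hI hS₀)

/-- Non-vacuity form. [cite: MochizukiGalSect2005, §4 p.33] -/
theorem nonempty_torsorDataH1 [T1Space G] (hD : IsClosed (P.D : Set G)) (hI : IsCompact (P.I : Set G))
    {S₀ : Subgroup G} (hS₀ : S₀ ∈ P.splittings) :
    haveI := P.ID_normal
    Nonempty (P.TorsorData
      ↥(ContH1.resKer P.ID (⊤ : Subgroup P.D) (P.isClosedComplement_of_mem_splittings hS₀).le_left)) :=
  ⟨P.torsorDataH1 hD hI hS₀⟩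

/-! #### The structure group is `H¹(D/I, I)` (degree-one inflation–restriction, abc-iut-L2-t12's `ContH1InfRes`) -/

open CategoryTheory TopRep ContRepresentation Literature.NumberTheory.GaloisRepresentations

omit [IsTopologicalGroup G] in
/-- `I` acts trivially on itself by conjugation (it is abelian). [cite: MochizukiGalSect2005, §4 p.33] -/
theorem conjNormal_ID_eq (n : P.D) (hn : n ∈ P.ID) (a : P.ID) :
    haveI := P.ID_normal
    MulAut.conjNormal ((MonoidHom.id P.D) n) a = a := by
  haveI := P.ID_normal
  apply Subtype.ext
  rw [MulAut.conjNormal_apply, MonoidHom.id_apply, ← setLike_mul_comm (s := P.ID) a.2 hn, mul_inv_cancel_right]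

/-- **`Ker(res : H¹(D, I) → H¹(I, I)) ≃* H¹(D/I, I)`** — so the structure group of the torsor is print's
`H¹(D_x/I_x, I_x)` (`= H¹(G_K, Ẑ(1))` once `D_x/I_x = G_K` and `I_x = Ẑ(1)` are read in).
[cite: MochizukiGalSect2005, §4 p.33] -/
def resKerEquivH1Quotient [T1Space G] {S₀ : Subgroup G} (hS₀ : S₀ ∈ P.splittings) :
    haveI := P.ID_normal
    ContH1.resKer P.ID (⊤ : Subgroup P.D) (P.isClosedComplement_of_mem_splittings hS₀).le_left ≃*
      Multiplicative (continuousCohomology 1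
        (quotConjTopRep (MonoidHom.id P.D) P.ID ⊤ P.conjNormal_ID_eq)) :=
  haveI := P.ID_normal
  (ContH1.kerResEquivQuotient (MonoidHom.id P.D) P.ID ⊤ (P.isClosedComplement_of_mem_splittings hS₀).le_left
    P.conjNormal_ID_eq continuous_id).symm

/-- **The [GalSect] §4 torsor with structure group `H¹(D/I, I)` itself.** [cite: MochizukiGalSect2005, §4 p.33] -/
def torsorDataH1Quotient [T1Space G] (hD : IsClosed (P.D : Set G)) (hI : IsCompact (P.I : Set G))
    {S₀ : Subgroup G} (hS₀ : S₀ ∈ P.splittings) :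
    haveI := P.ID_normal
    P.TorsorData (Multiplicative (continuousCohomology 1
      (quotConjTopRep (MonoidHom.id P.D) P.ID ⊤ P.conjNormal_ID_eq))) :=
  haveI := P.ID_normal
  TorsorData.ofEquiv ((P.splittingClassEquivResKer hD hI hS₀).trans (P.resKerEquivH1Quotient hS₀).toEquiv)

end Torsor

end CuspPair

end GalSect

end Literature.AnabelianGeometry.EtaleTheta

/-! ### Every cusp of every tempered curve (with a splitting) -/

namespace Literature.AnabelianGeometry.SemiGraphs.TemperedCurve

open Literature.AnabelianGeometry.EtaleTheta Literature.AnabelianGeometry.EtaleTheta.GalSect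

variable {p : ℕ} [Fact p.Prime] (X : TemperedCurve p)

/-- At a cusp, `I_x ≅ Ẑ` is ABELIAN. [cite: MochizukiSemiAnbd2006, §6 p.71] -/
theorem isMulCommutative_inertia {x : X.Pt} (hx : X.IsCusp x) : IsMulCommutative (X.inertia x) := by
  obtain ⟨e⟩ := X.inertia_equiv_zHat x hx
  have e' : X.inertia x ≃* ZHat := e.toMulEquiv
  exact ⟨⟨Literature.AnabelianGeometry.AbsoluteAnabelian.ZHatCompletion.mul_comm_of_mulEquiv e'⟩⟩

/-- At a cusp, `I_x ≅ Ẑ` is COMPACT. [cite: MochizukiSemiAnbd2006, §6 p.71] -/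
theorem isCompact_inertia {x : X.Pt} (hx : X.IsCusp x) : IsCompact (X.inertia x : Set X.PiTemp) := by
  obtain ⟨e⟩ := X.inertia_equiv_zHat x hx
  have e' : X.inertia x ≃ₜ ZHat := e.toHomeomorph
  haveI : CompactSpace (X.inertia x) := e'.symm.compactSpace
  exact isCompact_iff_compactSpace.mpr inferInstance

/-- **[GalSect] §4 for the pair `(D_x, I_x)` of a tempered curve**: at a cusp `x` with a splitting `S₀`, the
splitting classes form a torsor under `Ker(res : H¹(D_x, I_x) → H¹(I_x, I_x))`.
[cite: MochizukiGalSect2005, §4 p.33] -/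
def cuspTorsorH1 [T1Space X.PiTemp] {x : X.Pt} (hx : X.IsCusp x) {S₀ : Subgroup X.PiTemp}
    (hS₀ : S₀ ∈ (cuspPairOf X x).splittings) :
    haveI : IsMulCommutative (cuspPairOf X x).I := X.isMulCommutative_inertia hx
    haveI := (cuspPairOf X x).ID_normal
    (cuspPairOf X x).TorsorData ↥(ContH1.resKer (cuspPairOf X x).ID (⊤ : Subgroup (cuspPairOf X x).D)
      ((cuspPairOf X x).isClosedComplement_of_mem_splittings hS₀).le_left) :=
  haveI : IsMulCommutative (cuspPairOf X x).I := X.isMulCommutative_inertia hx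
  (cuspPairOf X x).torsorDataH1 (X.isClosed_decomp x) (X.isCompact_inertia hx) hS₀

end Literature.AnabelianGeometry.SemiGraphs.TemperedCurve


end
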